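import Summits.KontsevichZagierPeriods.KontsevichZagierPeriods.Theorems.HeckeMultiplicityOneManinStokesTileMap
import Summits.KontsevichZagierPeriods.KontsevichZagierPeriods.Theorems.HeckeMultiplicityOneManinStokesTileRamanujan

/-!
# `ManinStokes` (stmt-KontsevichZagierPeriods-5277): the Jacobian integrand `‖j′‖·‖(ω/dj)′‖` near a point

Support file (prover-owned, `--supports stmt-KontsevichZagierPeriods-5277`). For the change of variables `u = j(z)`
in the bulk integral of the Cauchy/Green argument one needs local integrability of `‖J'(z)‖ · ‖F'(z)‖`
(`J = j ∘ ofComplex`, `F = (ω/dj) ∘ ofComplex`) at every point of the closed tile, corners included. Main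
result `exists_ball_norm_deriv_mul_le`: every `z₀` with `im z₀ > 0` has a ball on which
`‖J'(z)‖‖F'(z)‖ ≤ C/|z − z₀|` off the centre — from the local factorisation `J' = (z − z₀)^m g` (isolated
zeros; `J'` is not identically zero near any point since `J'(1/4 + 2i) ≠ 0`) and `J' F = 2πi φ`.

References: M. Kontsevich, D. Zagier, *Periods* (2001), §1.2; standard complex analysis (isolated zeros,
Mathlib `AnalyticAt.exists_eventuallyEq_pow_smul_nonzero_iff`). No definitions, no named facts.
-/

noncomputable section

open scoped MatrixGroups ModularForm Modular Manifold Topology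
open CongruenceSubgroup Complex Set Filter MeasureTheory ModularForm
open UpperHalfPlane hiding I
open Literature.NumberTheory.EllipticCurves Literature.NumberTheory.EllipticCurves.ModularForms

namespace Summit.KontsevichZagierPeriods.HeckeMultiplicityOne.ManinStokes

/-! ## The Jacobian integrand `‖j'‖ · ‖(ω/dj)'‖` near a point of the upper half plane

For the change of variables `u = j(z)` in the bulk integral `∬_{im u<0} |G'(u)| du dz̄` we need local
integrability of `‖J'(z)‖ · ‖F'(z)‖`, `J = j ∘ ofComplex`, `F = (ω/dj) ∘ ofComplex`, at every point `z₀`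
of the closed tile, including the corners `i`, `ρ' = e^{iπ/3}` where `J'` vanishes and `F` has a pole: from
the local factorisation `J' = (z − z₀)^m g` (isolated zeros) and `J' F = 2πi φ`, one gets
`J' F' = 2πi φ' − (m/(z − z₀) + g'/g) · 2πi φ`, whence `‖J'‖‖F'‖ ≤ C/|z − z₀|` near `z₀`. -/

section LocalBound

open Metric

/-- `J' = (j ∘ ofComplex)'` is analytic on the upper half plane. [folklore] -/
theorem analyticOnNhd_deriv_kleinJ :
    AnalyticOnNhd ℂ (deriv (kleinJ ∘ ofComplex)) {z : ℂ | 0 < z.im} :=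
  (differentiableOn_kleinJ.analyticOnNhd (isOpen_lt continuous_const Complex.continuous_im)).deriv

/-- `J'(z) ≠ 0` at a point where `j` is not real (not an elliptic point). [folklore] -/
theorem deriv_kleinJ_ne_zero_of_im_ne_zero {z : ℍ} (hz : (kleinJ z).im ≠ 0) :
    deriv (kleinJ ∘ ofComplex) z ≠ 0 := by
  rw [deriv_kleinJ_ne_zero_iff]
  constructor
  · intro h
    obtain ⟨γ, hγ⟩ := E₄_eq_zero_iff.mp h
    have : kleinJ z = 0 := by rw [← hγ, kleinJ_smul, kleinJ_rho]
    rw [this] at hz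
    simp at hz
  · intro h
    obtain ⟨γ, hγ⟩ := E₆_eq_zero_iff.mp h
    have : kleinJ z = 1728 := by rw [← hγ, kleinJ_smul, kleinJ_I]
    rw [this] at hz
    norm_num at hz

/-- `J'` does not vanish identically near any point of the upper half plane (identity principle on
the connected upper half plane, `J'(1/4 + 2i) ≠ 0`). [folklore] -/
theorem not_eventually_deriv_kleinJ_eq_zero {z₀ : ℂ} (hz₀ : 0 < z₀.im) :
    ¬ ∀ᶠ z in 𝓝 z₀, deriv (kleinJ ∘ ofComplex) z = 0 := by
  intro h
  have hpre : IsPreconnected {z : ℂ | 0 < z.im} := (convex_halfSpace_im_gt (0 : ℝ)).isPreconnected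
  have hzero := analyticOnNhd_deriv_kleinJ.eqOn_zero_of_preconnected_of_eventuallyEq_zero hpre hz₀ h
  have hpt : (((1 / 4 : ℝ) : ℂ) + (2 : ℝ) * I) ∈ {z : ℂ | 0 < z.im} := by
    show (0 : ℝ) < (((1 / 4 : ℝ) : ℂ) + (2 : ℝ) * I).im
    simp
  have h1 := hzero hpt
  refine deriv_kleinJ_ne_zero_of_im_ne_zero (z := ofComplex (((1 / 4 : ℝ) : ℂ) + (2 : ℝ) * I))
    kleinJ_quarter_add_two_I_im_neg.ne ?_
  rw [coe_ofComplex_mk two_pos]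
  exact h1

variable {φ : ℍ → ℂ}

/-- Near a point `z` of the upper half plane with `J'(z) ≠ 0`: `J' · F = 2πi φ` identically
(`deriv_kleinJ_mul_djQuot`, `J'` continuous). [folklore] -/
theorem deriv_kleinJ_mul_djQuot_eventually (φ : ℍ → ℂ) {z : ℂ} (hz : 0 < z.im)
    (hJ : deriv (kleinJ ∘ ofComplex) z ≠ 0) :
    (fun w => deriv (kleinJ ∘ ofComplex) w * (djQuot φ ∘ ofComplex) w) =ᶠ[𝓝 z]
      fun w => 2 * Real.pi * I * (φ ∘ ofComplex) w := by
  have hc : ContinuousAt (deriv (kleinJ ∘ ofComplex)) z :=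
    (analyticOnNhd_deriv_kleinJ z hz).continuousAt
  have h1 : ∀ᶠ w in 𝓝 z, deriv (kleinJ ∘ ofComplex) w ≠ 0 := hc.eventually_ne hJ
  have h2 : ∀ᶠ w in 𝓝 z, 0 < w.im := (isOpen_lt continuous_const Complex.continuous_im).mem_nhds hz
  filter_upwards [h1, h2] with w hw1 hw2
  have hw : ofComplex w = (⟨w, hw2⟩ : ℍ) := ofComplex_apply_of_im_pos hw2
  have hw1' : deriv (kleinJ ∘ ofComplex) ((⟨w, hw2⟩ : ℍ) : ℂ) ≠ 0 := hw1
  obtain ⟨h4, h6⟩ := (deriv_kleinJ_ne_zero_iff _).mp hw1'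
  have := deriv_kleinJ_mul_djQuot h4 h6 φ
  simp only [Function.comp_apply, hw]
  exact this

/-- `F = (ω/dj) ∘ ofComplex` is complex differentiable at a point of the upper half plane where
`J' ≠ 0`. [folklore] -/
theorem differentiableAt_djQuot_of_deriv_kleinJ_ne_zero (hφ : MDifferentiable 𝓘(ℂ) 𝓘(ℂ) φ) {z : ℂ}
    (hz : 0 < z.im) (hJ : deriv (kleinJ ∘ ofComplex) z ≠ 0) :
    DifferentiableAt ℂ (djQuot φ ∘ ofComplex) z := by
  have hJ' : deriv (kleinJ ∘ ofComplex) ((⟨z, hz⟩ : ℍ) : ℂ) ≠ 0 := hJ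
  obtain ⟨h4, h6⟩ := (deriv_kleinJ_ne_zero_iff _).mp hJ'
  exact differentiableAt_djQuot_comp_ofComplex hφ h4 h6

/-- **Local bound for the Jacobian integrand**: every point `z₀` of the upper half plane has a ball on
which `‖J'(z)‖ · ‖F'(z)‖ ≤ C/|z − z₀|` off the centre (`F = (ω/dj) ∘ ofComplex`, `φ` holomorphic).
[folklore] -/
theorem exists_ball_norm_deriv_mul_le (hφ : MDifferentiable 𝓘(ℂ) 𝓘(ℂ) φ) {z₀ : ℂ} (hz₀ : 0 < z₀.im) :
    ∃ r > 0, ∃ C, ∀ z ∈ ball z₀ r, z ≠ z₀ →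
      ‖deriv (kleinJ ∘ ofComplex) z‖ * ‖deriv (djQuot φ ∘ ofComplex) z‖ ≤ C * ‖z - z₀‖⁻¹ := by
  set J' := deriv (kleinJ ∘ ofComplex) with hJ'
  set F := djQuot φ ∘ ofComplex with hF
  set Φ := φ ∘ ofComplex with hΦ
  have hJa : AnalyticAt ℂ J' z₀ := analyticOnNhd_deriv_kleinJ z₀ hz₀
  obtain ⟨m, g, hga, hg0, hfac⟩ :=
    hJa.exists_eventuallyEq_pow_smul_nonzero_iff.mpr (not_eventually_deriv_kleinJ_eq_zero hz₀)
  have hΦd : DifferentiableOn ℂ Φ {z : ℂ | 0 < z.im} := UpperHalfPlane.mdifferentiable_iff.mp hφ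
  have hc0 : 0 < ‖g z₀‖ / 2 := half_pos (norm_pos_iff.mpr hg0)
  have hev : ∀ᶠ z in 𝓝 z₀, 0 < z.im ∧ J' z = (z - z₀) ^ m • g z ∧ AnalyticAt ℂ g z ∧
      ‖g z₀‖ / 2 ≤ ‖g z‖ := by
    have h0 : ∀ᶠ z in 𝓝 z₀, 0 < z.im := (isOpen_lt continuous_const Complex.continuous_im).mem_nhds hz₀
    refine h0.and (hfac.and (hga.eventually_analyticAt.and ?_))
    have hgc : ContinuousAt g z₀ := hga.continuousAt
    have h1 : ∀ᶠ z in 𝓝 z₀, dist (g z) (g z₀) < ‖g z₀‖ / 2 :=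
      Metric.tendsto_nhds.mp hgc _ hc0
    filter_upwards [h1] with z hz
    rw [dist_eq_norm] at hz
    have := norm_sub_norm_le (g z₀) (g z)
    rw [← norm_neg, neg_sub] at hz
    linarith
  obtain ⟨r₁, hr₁, hball⟩ := Metric.eventually_nhds_iff_ball.mp hev
  set r := r₁ / 2 with hr
  have hr0 : 0 < r := half_pos hr₁
  have hsub : closedBall z₀ r ⊆ ball z₀ r₁ := closedBall_subset_ball (half_lt_self hr₁)
  have hgd : DifferentiableOn ℂ g (ball z₀ r₁) := fun z hz =>
    (hball z hz).2.2.1.differentiableAt.differentiableWithinAt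
  have hg'c : ContinuousOn (deriv g) (ball z₀ r₁) := (hgd.analyticOnNhd isOpen_ball).deriv.continuousOn
  have hΦd' : DifferentiableOn ℂ Φ (ball z₀ r₁) := hΦd.mono fun z hz => (hball z hz).1
  have hΦ'c : ContinuousOn (deriv Φ) (ball z₀ r₁) := (hΦd'.analyticOnNhd isOpen_ball).deriv.continuousOn
  obtain ⟨MΦ, hMΦ⟩ := (isCompact_closedBall z₀ r).exists_bound_of_continuousOn
    (hΦd'.continuousOn.mono hsub)
  obtain ⟨MΦ', hMΦ'⟩ := (isCompact_closedBall z₀ r).exists_bound_of_continuousOn (hΦ'c.mono hsub)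
  obtain ⟨Mg', hMg'⟩ := (isCompact_closedBall z₀ r).exists_bound_of_continuousOn (hg'c.mono hsub)
  set c := ‖g z₀‖ / 2 with hc
  refine ⟨r, hr0, 2 * Real.pi * (|MΦ'| * r + |MΦ| * (m + |Mg'| / c * r)), fun z hz hne => ?_⟩
  have hzmem : z ∈ closedBall z₀ r := ball_subset_closedBall hz
  have hz₁ : z ∈ ball z₀ r₁ := hsub hzmem
  obtain ⟨hzim, hzfac, hzga, hzg⟩ := hball z hz₁
  have hgz : g z ≠ 0 := fun h0 => by rw [h0, norm_zero] at hzg; linarith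
  have hzz : z - z₀ ≠ 0 := sub_ne_zero.mpr hne
  have hJz : J' z ≠ 0 := by
    rw [hzfac, smul_eq_mul]; exact mul_ne_zero (pow_ne_zero _ hzz) hgz
  -- `J''(z)` from the factorisation
  have hfacz : J' =ᶠ[𝓝 z] fun w => (w - z₀) ^ m * g w := by
    filter_upwards [isOpen_ball.mem_nhds hz₁] with w hw
    rw [(hball w hw).2.1, smul_eq_mul]
  have hgdz : HasDerivAt g (deriv g z) z := hzga.differentiableAt.hasDerivAt
  have hpow : HasDerivAt (fun w : ℂ => (w - z₀) ^ m) ((m : ℂ) * (z - z₀) ^ (m - 1)) z := by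
    simpa using ((hasDerivAt_id z).sub_const z₀).fun_pow m
  have hJ'' : deriv J' z = (m : ℂ) * (z - z₀) ^ (m - 1) * g z + (z - z₀) ^ m * deriv g z := by
    rw [hfacz.deriv_eq]
    exact (hpow.fun_mul hgdz).deriv
  -- differentiate `J' F = 2πi Φ` at `z`
  have hprod := deriv_kleinJ_mul_djQuot_eventually φ hzim hJz
  have hFd : DifferentiableAt ℂ F z := differentiableAt_djQuot_of_deriv_kleinJ_ne_zero hφ hzim hJz
  have hJ'd : DifferentiableAt ℂ J' z := (analyticOnNhd_deriv_kleinJ z hzim).differentiableAt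
  have hΦdz : DifferentiableAt ℂ Φ z := hΦd'.differentiableAt (isOpen_ball.mem_nhds hz₁)
  have hprod' : (fun w => J' w * F w) =ᶠ[𝓝 z] fun w => 2 * Real.pi * I * Φ w := hprod
  have hderiv : deriv J' z * F z + J' z * deriv F z = 2 * Real.pi * I * deriv Φ z := by
    have h1 := hprod'.deriv_eq
    rw [deriv_fun_mul hJ'd hFd, deriv_const_mul _ hΦdz] at h1
    exact h1
  have hFz : J' z * F z = 2 * Real.pi * I * Φ z := hprod'.self_of_nhds
  -- the key identity, multiplied through by `(z - z₀) g z`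
  have hkey : J' z * deriv F z * ((z - z₀) * g z) =
      (2 * Real.pi * I * deriv Φ z) * ((z - z₀) * g z) -
        ((m : ℂ) * g z + (z - z₀) * deriv g z) * (2 * Real.pi * I * Φ z) := by
    have e1 : J' z * deriv F z = 2 * Real.pi * I * deriv Φ z - deriv J' z * F z := by
      rw [← hderiv]; ring
    have e2 : deriv J' z * (z - z₀) = ((m : ℂ) * g z + (z - z₀) * deriv g z) * (z - z₀) ^ m := by
      rw [hJ'']
      rcases Nat.eq_zero_or_pos m with hm | hm
      · subst hm; simp [mul_comm]
      · obtain ⟨k, rfl⟩ := Nat.exists_eq_add_of_le' hm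
        simp only [Nat.add_sub_cancel, pow_succ]
        push_cast
        ring
    have e3 : (z - z₀) ^ m * F z = 2 * Real.pi * I * Φ z / g z := by
      rw [eq_div_iff hgz, ← hFz, hzfac, smul_eq_mul]; ring
    calc J' z * deriv F z * ((z - z₀) * g z)
        = (2 * Real.pi * I * deriv Φ z) * ((z - z₀) * g z) - (deriv J' z * (z - z₀)) * F z * g z := by
          rw [e1]; ring
      _ = (2 * Real.pi * I * deriv Φ z) * ((z - z₀) * g z) -
          ((m : ℂ) * g z + (z - z₀) * deriv g z) * ((z - z₀) ^ m * F z) * g z := by rw [e2]; ring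
      _ = _ := by rw [e3]; field_simp
  -- norms
  have b1 : ‖deriv Φ z‖ ≤ |MΦ'| := (hMΦ' z hzmem).trans (le_abs_self _)
  have b2 : ‖Φ z‖ ≤ |MΦ| := (hMΦ z hzmem).trans (le_abs_self _)
  have b3 : ‖deriv g z‖ ≤ |Mg'| := (hMg' z hzmem).trans (le_abs_self _)
  have hzr : ‖z - z₀‖ ≤ r := by
    have := mem_ball_iff_norm.mp hz; linarith
  have hzpos : 0 < ‖z - z₀‖ := norm_pos_iff.mpr hzz
  have hgpos : 0 < ‖g z‖ := norm_pos_iff.mpr hgz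
  have h2π : ‖(2 * Real.pi * I : ℂ)‖ = 2 * Real.pi := by
    simp [abs_of_pos Real.pi_pos]
  rw [le_mul_inv_iff₀ hzpos]
  -- `‖J' F'‖ · |z - z₀| · ‖g z‖ ≤ C ‖g z‖`
  have hmain : ‖J' z * deriv F z‖ * ‖z - z₀‖ * ‖g z‖ ≤
      (2 * Real.pi * (|MΦ'| * r + |MΦ| * (m + |Mg'| / c * r))) * ‖g z‖ := by
    have hn : ‖J' z * deriv F z‖ * ‖z - z₀‖ * ‖g z‖ = ‖J' z * deriv F z * ((z - z₀) * g z)‖ := by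
      rw [norm_mul _ ((z - z₀) * g z), norm_mul (z - z₀), mul_assoc]
    rw [hn, hkey]
    have t1 : ‖(2 * Real.pi * I * deriv Φ z) * ((z - z₀) * g z)‖ ≤ 2 * Real.pi * |MΦ'| * (r * ‖g z‖) := by
      rw [norm_mul, norm_mul, norm_mul (z - z₀), h2π]
      gcongr
    have t2 : ‖((m : ℂ) * g z + (z - z₀) * deriv g z) * (2 * Real.pi * I * Φ z)‖ ≤
        (m * ‖g z‖ + r * |Mg'|) * (2 * Real.pi * |MΦ|) := by
      rw [norm_mul, norm_mul, h2π]
      gcongr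
      calc ‖(m : ℂ) * g z + (z - z₀) * deriv g z‖ ≤ ‖(m : ℂ) * g z‖ + ‖(z - z₀) * deriv g z‖ :=
            norm_add_le _ _
        _ = m * ‖g z‖ + ‖z - z₀‖ * ‖deriv g z‖ := by rw [norm_mul, norm_mul, Complex.norm_natCast]
        _ ≤ m * ‖g z‖ + r * |Mg'| := by gcongr
    have hcg : c ≤ ‖g z‖ := hzg
    have hπ := Real.pi_pos
    have t3 : r * |Mg'| * (2 * Real.pi * |MΦ|) ≤ 2 * Real.pi * (|MΦ| * (|Mg'| / c * r)) * ‖g z‖ := by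
      rw [show 2 * Real.pi * (|MΦ| * (|Mg'| / c * r)) * ‖g z‖ =
        r * |Mg'| * (2 * Real.pi * |MΦ|) * (‖g z‖ / c) by field_simp]
      have : 1 ≤ ‖g z‖ / c := by rw [le_div_iff₀ hc0]; linarith
      have h0 : 0 ≤ r * |Mg'| * (2 * Real.pi * |MΦ|) := by positivity
      nlinarith
    calc ‖(2 * Real.pi * I * deriv Φ z) * ((z - z₀) * g z) -
          ((m : ℂ) * g z + (z - z₀) * deriv g z) * (2 * Real.pi * I * Φ z)‖
        ≤ ‖(2 * Real.pi * I * deriv Φ z) * ((z - z₀) * g z)‖ +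
          ‖((m : ℂ) * g z + (z - z₀) * deriv g z) * (2 * Real.pi * I * Φ z)‖ := norm_sub_le _ _
      _ ≤ 2 * Real.pi * |MΦ'| * (r * ‖g z‖) + (m * ‖g z‖ + r * |Mg'|) * (2 * Real.pi * |MΦ|) :=
          add_le_add t1 t2
      _ ≤ (2 * Real.pi * (|MΦ'| * r + |MΦ| * (m + |Mg'| / c * r))) * ‖g z‖ := by nlinarith
  rw [norm_mul] at hmain
  exact le_of_mul_le_mul_right hmain hgpos

end LocalBound


end Summit.KontsevichZagierPeriods.HeckeMultiplicityOne.ManinStokes
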